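import Mathlib
import Summits.AtomisticToContinuum.Crystallization.Theses.ReggeStarCoercivity
import Summits.AtomisticToContinuum.Crystallization.Theorems.DefectFreeCrystallizes.Negative.PredicateAPI
import Summits.AtomisticToContinuum.Crystallization.Theorems.ChargedEnergyGap.Negative.Periodisation
import Summits.AtomisticToContinuum.Crystallization.Theorems.ReggeStarCoercivityZeroDefectDensityReduction

/-!
# `ZeroDefectDensity` (stmt-AtomisticToContinuum-13604) from the TORUS form of the crux

Support item `ReggeStarCoercivity.ZeroDefectDensity`: along every sequence of Lennard-Jones ground
states the fraction of `1/20`-defective first shells tends to `0`.  The sibling helper files record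
`ZeroDefectDensity ⇐ StarCoercivity ∧ CrysEnergyUpper` (crux 13600; `…ZeroDefectDensityReduction`)
and `ZeroDefectDensity ⇐ CoerciveTwoShellGap` (shared target 13956; `…ZeroDefectDensityTwoShell`).
This file records the third unblocker, the route's own PERIODIC crux `PeriodicStarCoercivity`
(stmt-AtomisticToContinuum-13602 — "the cleanest home of the mechanism": finite Delaunay
triangulation on `ℝ³/G`, exact flatness, no boundary):

* `image_toFinset_inter_points_periodise` — for the far periodisation `periodise x c hc hN` of an
  injective configuration with the cubic lattice `cℤ³`, `c ≥ 2Σ‖xᵢ‖ + 2` (the tree's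
  `ChargedEnergyGapNegative.periodise`, any admissible period `c`), the shell of `xᵢ` READ IN
  `P.points` (punctured closed `6/5`-ball, recentred, rescaled — the sub-term of
  `PeriodicStarCoercivity`) is the shell of `xᵢ` read in `x` (the sub-term of `StarCoercivity` /
  `ZeroDefectDensity`, `PredicateAPI.shell`): periodic images are `≥ 2` away.
* `card_filter_motif_periodise` — hence the number of motif points of that periodisation failing any
  predicate agreeing with `¬ Good x` on the `xᵢ` is `defects x`.
* `zeroDefectDensity_of_periodicStarCoercivity` — **`PeriodicStarCoercivity → ZeroDefectDensity`**:
  feeding the periodisation to 13602 gives the crux inequality of 13600 with `C = 0`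
  (`e(P) ≤ E_LJ(x)/N` by `energyPerParticle_periodise_le`), and the landed glue
  `zeroDefectDensity_of_starCoercivity` with `CrysEnergyUpper_holds` (item 11865) finishes.

The standalone edge `PeriodicStarCoercivity → StarCoercivity` is the crux line's
`StarCoercivityPeriodisation.starCoercivity_of_periodicStarCoercivity`
(`ReggeStarCoercivityStarCoercivityPeriodisation.lean`, with its own copy of the periodisation); it
is re-derived inline here for the tree's general-period `periodise`, whose shell identity the two
lemmas above supply.  Upshot for the item: 13604 closes by a one-liner as soon as ANY of 13600
(`zeroDefectDensity_of_starCoercivity · CrysEnergyUpper_holds`), 13602 (this file) or 13956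
(`zeroDefectDensity_of_coerciveTwoShellGap`) lands — three dresses of one open statement, the
energetic crystallization lower bound at positive defect density (Blanc–Lewin 2015, §2.3).
-/

noncomputable section

namespace Summit.AtomisticToContinuum.Crystallization.Theorems.ZeroDefectDensity

open scoped Classical
open Summit.AtomisticToContinuum.Crystallization.Theses.ReggeStarCoercivity
open Summit.AtomisticToContinuum.Crystallization.Theorems.DefectFreeCrystallizes.Negative.PredicateAPI
open Summit.AtomisticToContinuum.Crystallization.Theorems.ChargedEnergyGapNegative
  (periodise motif_periodise two_le_dist_of_mem_points energyPerParticle_periodise_le period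
    periodUnit)
open Literature.MathematicalPhysics.StatisticalMechanics Literature.Geometry.DiscreteGeometry
open Filter Topology

/-! ## Shells of the far periodisation are the shells of `x` -/

section Periodise

variable {N : ℕ} {x : Fin N → EuclideanSpace ℝ (Fin 3)}

/-- **The shells of a far periodisation, read in `P.points`, are the shells of `x`.**  For the
periodisation `P = periodise x c hc hN` (cubic lattice `cℤ³`, `c ≥ 2Σ‖xᵢ‖ + 2`) of an injective
configuration, the points of `P` in the punctured closed `6/5`-ball about `xᵢ`, recentred at `xᵢ`
and rescaled by `a⁻¹` — literally the sub-term of `ReggeStarCoercivity.PeriodicStarCoercivity` —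
form exactly `shell x i a`, the sub-term of `StarCoercivity`/`ZeroDefectDensity`: every point of `P`
other than the `xⱼ` is at distance `≥ 2 > 6/5` from `xᵢ` (`two_le_dist_of_mem_points`).
(Adapted from the crux workfile `Cruxes/StarCoercivity/Disproof.lean`, §5.) [folklore] -/
theorem image_toFinset_inter_points_periodise (hx : Function.Injective x) (c : ℝˣ)
    (hc : period x ≤ (c : ℝ)) (hN : 0 < N) (i : Fin N) (a : ℝ)
    (hfin : ((Metric.closedBall (x i) (6 / 5) \ {x i}) ∩ (periodise x c hc hN).points).Finite) :
    hfin.toFinset.image (fun y => a⁻¹ • (y - x i)) = shell x i a := by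
  ext v
  simp only [Finset.mem_image, Set.Finite.mem_toFinset, Set.mem_inter_iff,
    Metric.mem_closedBall, Set.mem_singleton_iff, shell, nbrs, Finset.mem_filter, Finset.mem_univ,
    true_and, Set.mem_sdiff]
  constructor
  · rintro ⟨y, ⟨⟨hyb, hys⟩, hyP⟩, rfl⟩
    have hex : ∃ j, y = x j := by
      by_contra hno
      push Not at hno
      have := two_le_dist_of_mem_points x c hc hN i hyP hno
      rw [dist_comm] at hyb
      linarith
    obtain ⟨j, rfl⟩ := hex
    exact ⟨j, ⟨fun hji => hys (by rw [hji]), by rwa [dist_comm] at hyb⟩, rfl⟩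
  · rintro ⟨j, ⟨hji, hd⟩, rfl⟩
    refine ⟨x j, ⟨⟨by rwa [dist_comm], fun h => hji (hx h)⟩, ?_⟩, rfl⟩
    exact (periodise x c hc hN).mem_points_of_mem_motif (by
      rw [motif_periodise]; exact Finset.mem_image_of_mem x (Finset.mem_univ j))

/-- Hence the number of motif points of the far periodisation failing ANY predicate `p` that agrees
with `¬ Good x` on the `xᵢ` equals `defects x` (the motif is `{xᵢ}`, in bijection with `Fin N`).
[folklore] -/
theorem card_filter_motif_periodise (hx : Function.Injective x) (c : ℝˣ) (hc : period x ≤ (c : ℝ))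
    (hN : 0 < N) (p : EuclideanSpace ℝ (Fin 3) → Prop) {hdec : DecidablePred p}
    (hp : ∀ i, p (x i) ↔ ¬ Good x i) :
    (@Finset.filter _ p hdec (periodise x c hc hN).motif).card = defects x := by
  rw [motif_periodise, Finset.filter_image, Finset.card_image_of_injective _ hx]
  unfold defects
  rw [Nat.card_eq_fintype_card, Fintype.card_subtype]
  congr 1
  exact Finset.filter_congr fun i _ => hp i

end Periodise

/-! ## 13602 ⇒ 13604 -/

/-- **`PeriodicStarCoercivity → ZeroDefectDensity`** (crux 13602 of route `ReggeStarCoercivity`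
alone implies support item 13604).  Step 1 (13602 ⇒ 13600 with `C = 0`, inline; the standalone
edge is `StarCoercivityPeriodisation.starCoercivity_of_periodicStarCoercivity`): given `g > 0` with
`e_per + g·#def(P)/#motif(P) ≤ e(P)` for every periodic `P`, take for `P` the far periodisation of
an injective `x : Fin N → ℝ³` (`N ≥ 1`; cubic period `2Σ‖xᵢ‖ + 2`): its motif is `{xᵢ}` (`N`
points), its defective motif points are exactly the defective sites of `x`
(`card_filter_motif_periodise`, `image_toFinset_inter_points_periodise`), and `e(P) ≤ E_LJ(x)/N`
since all cross terms are values of `V_LJ` at distances `≥ 2`, hence `≤ 0`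
(`energyPerParticle_periodise_le`); multiplying by `N`, `N·e_per + g·#Def(x) ≤ E_LJ(x)` (`N = 0`:
both sides vanish).  Step 2: `zeroDefectDensity_of_starCoercivity` (ground states are injective with
`E_LJ = E(N)`, `E(N)/N → e_∞ ≤ e_per` by `CrysEnergyUpper_holds`, squeeze). [folklore] -/
theorem zeroDefectDensity_of_periodicStarCoercivity (h : PeriodicStarCoercivity) :
    ZeroDefectDensity := by
  obtain ⟨g, hg, hP⟩ := h
  have hX : StarCoercivity := by
    refine ⟨g, hg, 0, fun N x hx => ?_⟩
    change (N : ℝ) * (⨅ Q : PeriodicConfiguration 3, Q.energyPerParticle lennardJones) +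
        g * (defects x : ℝ) - 0 * (N : ℝ) ^ (2 / 3 : ℝ) ≤ interactionEnergy lennardJones x
    rw [zero_mul, sub_zero]
    rcases Nat.eq_zero_or_pos N with rfl | hN
    · rw [defects_eq_of_le_twelve (by norm_num) x, interactionEnergy_of_subsingleton]
      simp
    · have key := hP (periodise x (periodUnit x) le_rfl hN)
      rw [card_filter_motif_periodise hx (periodUnit x) le_rfl hN _ (fun i => ?_)] at key
      · have hcardm : (((periodise x (periodUnit x) le_rfl hN).motif.card : ℕ) : ℝ) = N := by
          rw [motif_periodise, Finset.card_image_of_injective _ hx]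
          simp
        rw [hcardm] at key
        have h2 := energyPerParticle_periodise_le hx (periodUnit x) le_rfl hN
        have hNr : (0 : ℝ) < N := by exact_mod_cast hN
        have h3 : (⨅ Q : PeriodicConfiguration 3, Q.energyPerParticle lennardJones) +
            g * (defects x : ℝ) / N ≤ interactionEnergy lennardJones x / N := key.trans h2
        calc (N : ℝ) * (⨅ Q : PeriodicConfiguration 3, Q.energyPerParticle lennardJones) +
              g * (defects x : ℝ)
            = ((⨅ Q : PeriodicConfiguration 3, Q.energyPerParticle lennardJones) +
                g * (defects x : ℝ) / N) * N := by
              field_simp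
          _ ≤ interactionEnergy lennardJones x / N * N := mul_le_mul_of_nonneg_right h3 hNr.le
          _ = interactionEnergy lennardJones x := by field_simp
      · simp only [image_toFinset_inter_points_periodise hx (periodUnit x) le_rfl hN i, Good]
  exact zeroDefectDensity_of_starCoercivity hX CrysEnergyUpper_holds

end Summit.AtomisticToContinuum.Crystallization.Theorems.ZeroDefectDensity

end
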